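import Mathlib
import Literature.NumberTheory.Sieve.IntervalResidueClassSieve
import Summits.Parity.GeneralizedHardyLittlewood.Theorems.ParityLeakOneFifthPlainSplitTwistedModel
import HarnessLib

/-!
# Route ParityLeakOneFifth, crux `ParityLeakSieve` (stmt-Parity-18381), skeleton `birth`:
# the Type-I comparison of stub S1, model side

For the model (the `z`-rough integers of `(x, 2x]`) and a modulus `d` free of primes `< w`
(`2 < z ≤ w ≤ L`), the count `N_b(d) = #{n ∈ (x,2x] : n z-rough, d ∣ n+2, P⁻(n+2) ≥ w}` is, after
`n + 2 = dk` and a shift of the window (dictionary of `…PlainSplitTwistedModel.lean`), the number of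
`r ≤ K₁ − K₀` (`K₁ = ⌊(2x+2)/d⌋`, `K₀ = ⌊(x+2)/d⌋`) avoiding two residue classes modulo each odd prime
`p < z`, one class modulo `2` and one class modulo each prime `z ≤ p < w`; the tree's interval sieve
(`IntervalClassSieve.abs_card_sub_le`) gives
`|N_b(d) − (K₁−K₀)·V(z)V_sh(z)Π_{z≤p<w}(1−1/p)| ≤ C (K₁−K₀) V V_sh Π e^{−log L/log w} + L²`
(`model_count_le`), the density product being `(1/2)∏_{2<p<z}(1−2/p)∏_{z≤p<w}(1−1/p) = V(z)V_sh(z)Π`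
(`prod_classes_eq`).
-/

namespace Summit.Parity.GeneralizedHardyLittlewood.Theorems.ParityLeakOneFifth

open Finset Real
open Literature.NumberTheory.Sieve

/-- The density product with two classes at the odd primes `< z`, one at `2` and one at the primes in
`[z, w)`: `∏_{p<w}(1 − c_p/p) = V(z)·V_sh(z)·∏_{z≤p<w}(1 − 1/p)` (`2 < z ≤ w`). -/
theorem prod_classes_eq {z w : ℝ} (hz : 2 < z) (hzw : z ≤ w) (c : ℕ → ℕ)
    (h2 : c 2 = 1) (hodd : ∀ p ∈ Nat.primesBelow ⌈z⌉₊, p ≠ 2 → c p = 2)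
    (hbig : ∀ p ∈ Nat.primesBelow ⌈w⌉₊, z ≤ (p : ℝ) → c p = 1) :
    ∏ p ∈ Nat.primesBelow ⌈w⌉₊, (1 - (c p : ℝ) / p) =
      (∏ p ∈ (Finset.range ⌈z⌉₊).filter Nat.Prime, (1 - 1 / (p : ℝ))) *
        (∏ p ∈ (Finset.range ⌈z⌉₊).filter (fun p : ℕ => p.Prime ∧ p ≠ 2), (1 - 1 / ((p : ℝ) - 1))) *
        ∏ p ∈ (Nat.primesBelow ⌈w⌉₊).filter (fun p : ℕ => z ≤ (p : ℝ)), (1 - 1 / (p : ℝ)) := by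
  set Pz := Nat.primesBelow ⌈z⌉₊ with hPz
  set Pw := Nat.primesBelow ⌈w⌉₊ with hPw
  have hPB : (Finset.range ⌈z⌉₊).filter Nat.Prime = Pz := rfl
  rw [hPB]
  -- split `Pw` into `Pz` and the primes in `[z, w)`
  have hsplit : Pw = Pz ∪ Pw.filter (fun p : ℕ => z ≤ (p : ℝ)) := by
    ext p
    simp only [hPw, hPz, Finset.mem_union, Finset.mem_filter, Nat.mem_primesBelow, Nat.lt_ceil]
    constructor
    · rintro ⟨hpw, hp⟩
      by_cases hpz : (p : ℝ) < z
      · exact Or.inl ⟨hpz, hp⟩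
      · exact Or.inr ⟨⟨hpw, hp⟩, not_lt.1 hpz⟩
    · rintro (⟨hpz, hp⟩ | ⟨⟨hpw, hp⟩, -⟩)
      · exact ⟨lt_of_lt_of_le hpz hzw, hp⟩
      · exact ⟨hpw, hp⟩
  have hdisj : Disjoint Pz (Pw.filter (fun p : ℕ => z ≤ (p : ℝ))) := by
    rw [Finset.disjoint_left]
    intro p hp hp'
    rw [hPz, Nat.mem_primesBelow, Nat.lt_ceil] at hp
    rw [Finset.mem_filter] at hp'
    linarith [hp.1, hp'.2]
  rw [hsplit, Finset.prod_union hdisj, ← hsplit]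
  -- the part `[z, w)`: `c p = 1`
  have hB : ∏ p ∈ Pw.filter (fun p : ℕ => z ≤ (p : ℝ)), (1 - (c p : ℝ) / p) =
      ∏ p ∈ Pw.filter (fun p : ℕ => z ≤ (p : ℝ)), (1 - 1 / (p : ℝ)) := by
    refine Finset.prod_congr rfl fun p hp => ?_
    rw [Finset.mem_filter] at hp
    rw [hbig p hp.1 hp.2, Nat.cast_one]
  rw [hB]
  -- the part `< z`: termwise `1 − c_p/p = (1 − 1/p)·g(p)` with `g 2 = 1`, `g p = 1 − 1/(p−1)`
  have h2mem : 2 ∈ Pz := by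
    rw [hPz, Nat.mem_primesBelow]
    exact ⟨Nat.lt_ceil.2 (by push_cast; linarith), Nat.prime_two⟩
  have hA : ∏ p ∈ Pz, (1 - (c p : ℝ) / p) =
      (∏ p ∈ Pz, (1 - 1 / (p : ℝ))) * ∏ p ∈ Pz, (if p = 2 then (1 : ℝ) else (1 - 1 / ((p : ℝ) - 1))) := by
    rw [← Finset.prod_mul_distrib]
    refine Finset.prod_congr rfl fun p hp => ?_
    by_cases hp2 : p = 2
    · subst hp2; rw [h2, if_pos rfl]; norm_num
    · have hpp : p.Prime := (Nat.mem_primesBelow.1 hp).2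
      have h3 : (3 : ℝ) ≤ p := by exact_mod_cast (by have := hpp.two_le; omega : 3 ≤ p)
      rw [hodd p hp hp2, if_neg hp2]
      have hp0 : (p : ℝ) ≠ 0 := by positivity
      have hp1 : (p : ℝ) - 1 ≠ 0 := by
        have : (0 : ℝ) < (p : ℝ) - 1 := by linarith
        exact this.ne'
      field_simp
      push_cast; ring
  rw [hA]
  have hG : ∏ p ∈ Pz, (if p = 2 then (1 : ℝ) else (1 - 1 / ((p : ℝ) - 1))) =
      ∏ p ∈ (Finset.range ⌈z⌉₊).filter (fun p : ℕ => p.Prime ∧ p ≠ 2), (1 - 1 / ((p : ℝ) - 1)) := by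
    rw [Finset.prod_ite, Finset.prod_const_one, one_mul]
    refine Finset.prod_congr ?_ fun _ _ => rfl
    ext p
    simp only [Finset.mem_filter, hPz, Nat.mem_primesBelow, Finset.mem_range]
    tauto
  rw [hG]

/-- **The model count in a progression.** There is `C > 0` such that for all `x d : ℕ` (`d ≥ 1`,
`x ≥ 1`), reals `2 < z ≤ w ≤ L`, and `d` free of primes `< w`:
`|#{n ∈ (x,2x] : n z-rough, w ≤ P⁻(n+2), d ∣ n+2} − (K₁−K₀)·V(z)V_sh(z)Π_{z≤p<w}(1−1/p)|
 ≤ C (K₁−K₀)·V V_sh Π·e^{−log L/log w} + L²` (`K₁ = ⌊(2x+2)/d⌋`, `K₀ = ⌊(x+2)/d⌋`). -/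
theorem model_count_le : ∃ C : ℝ, 0 < C ∧ ∀ (x d : ℕ) (z w L : ℝ), 0 < d → 1 ≤ x → 2 < z → z ≤ w → w ≤ L →
    (∀ p : ℕ, p.Prime → (p : ℝ) < w → ¬ p ∣ d) →
    |(#((Finset.Ioc x (2 * x)).filter (fun n : ℕ => (∀ p ∈ n.primeFactors, z ≤ (p : ℝ)) ∧
        w ≤ ((n + 2).minFac : ℝ) ∧ d ∣ n + 2)) : ℝ) -
      (((2 * x + 2) / d - (x + 2) / d : ℕ) : ℝ) *
        ((∏ p ∈ (Finset.range ⌈z⌉₊).filter Nat.Prime, (1 - 1 / (p : ℝ))) *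
          (∏ p ∈ (Finset.range ⌈z⌉₊).filter (fun p : ℕ => p.Prime ∧ p ≠ 2), (1 - 1 / ((p : ℝ) - 1))) *
          ∏ p ∈ (Nat.primesBelow ⌈w⌉₊).filter (fun p : ℕ => z ≤ (p : ℝ)), (1 - 1 / (p : ℝ)))| ≤
      C * (((2 * x + 2) / d - (x + 2) / d : ℕ) : ℝ) *
        ((∏ p ∈ (Finset.range ⌈z⌉₊).filter Nat.Prime, (1 - 1 / (p : ℝ))) *
          (∏ p ∈ (Finset.range ⌈z⌉₊).filter (fun p : ℕ => p.Prime ∧ p ≠ 2), (1 - 1 / ((p : ℝ) - 1))) *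
          ∏ p ∈ (Nat.primesBelow ⌈w⌉₊).filter (fun p : ℕ => z ≤ (p : ℝ)), (1 - 1 / (p : ℝ))) *
        Real.exp (-(Real.log L / Real.log w)) + L ^ 2 := by
  obtain ⟨C, hC, hI⟩ := IntervalClassSieve.abs_card_sub_le 2
  refine ⟨C, hC, fun x d z w L hd hx hz2 hzw hwL hdw => ?_⟩
  set K₀ : ℕ := (x + 2) / d with hK₀
  set K₁ : ℕ := (2 * x + 2) / d with hK₁
  have hK : K₀ ≤ K₁ := Nat.div_le_div_right (by omega)
  -- the classes
  set Kc : ℕ → Finset ℕ := fun p =>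
    if (p : ℝ) < z then ({0, ((2 : ZMod p) * ((d : ZMod p))⁻¹).val} : Finset ℕ) else {0} with hKc
  have hKc_lt : ∀ p : ℕ, p.Prime → ∀ u ∈ Kc p, u < p := by
    intro p hp u hu
    simp only [hKc] at hu
    split_ifs at hu with h
    · rcases Finset.mem_insert.1 hu with rfl | hu'
      · exact hp.pos
      · rw [Finset.mem_singleton] at hu'; rw [hu']
        haveI := Fact.mk hp
        exact ZMod.val_lt _
    · rw [Finset.mem_singleton] at hu; rw [hu]; exact hp.pos
  -- Step 1: the count as a sum over `k`, then over the shifted window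
  haveI hQ : DecidablePred (fun m : ℕ => (∀ p ∈ (m - 2).primeFactors, z ≤ (p : ℝ)) ∧ w ≤ (m.minFac : ℝ)) :=
    Classical.decPred _
  have hcount : (#((Finset.Ioc x (2 * x)).filter (fun n : ℕ => (∀ p ∈ n.primeFactors, z ≤ (p : ℝ)) ∧
      w ≤ ((n + 2).minFac : ℝ) ∧ d ∣ n + 2)) : ℝ) =
      #((Finset.Icc 1 (K₁ - K₀)).filter (fun r => ∀ p ∈ Nat.primesBelow ⌈w⌉₊,
        r % p ∉ (Kc p).image (fun u : ℕ => (u + (p - K₀ % p)) % p))) := by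
    -- as sums of `1`
    have e1 : (#((Finset.Ioc x (2 * x)).filter (fun n : ℕ => (∀ p ∈ n.primeFactors, z ≤ (p : ℝ)) ∧
        w ≤ ((n + 2).minFac : ℝ) ∧ d ∣ n + 2)) : ℝ) =
        ∑ n ∈ (Finset.Ioc x (2 * x)).filter (fun n : ℕ =>
          ((∀ p ∈ (n + 2 - 2).primeFactors, z ≤ (p : ℝ)) ∧ w ≤ ((n + 2).minFac : ℝ)) ∧ d ∣ n + 2),
          (1 : ℝ) := by
      rw [Finset.sum_const, nsmul_eq_mul, mul_one]
      congr 2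
      refine Finset.filter_congr fun n _ => ?_
      simp only [Nat.add_sub_cancel]
      exact ⟨fun ⟨h1, h2, h3⟩ => ⟨⟨h1, h2⟩, h3⟩, fun ⟨⟨h1, h2⟩, h3⟩ => ⟨h1, h2, h3⟩⟩
    have hshift := sum_filter_dvd_shift_eq x hd (fun m => (∀ p ∈ (m - 2).primeFactors, z ≤ (p : ℝ)) ∧
      w ≤ (m.minFac : ℝ)) (fun _ => (1 : ℝ))
    simp only at hshift
    -- the conditions on `k` as residue classes
    have e2 : (Finset.Ioc K₀ K₁).filter (fun k => (∀ p ∈ (d * k - 2).primeFactors, z ≤ (p : ℝ)) ∧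
        w ≤ ((d * k).minFac : ℝ)) =
        (Finset.Ioc K₀ K₁).filter (fun k => ∀ p ∈ Nat.primesBelow ⌈w⌉₊, k % p ∉ Kc p) := by
      refine Finset.filter_congr fun k hk => ?_
      rw [Finset.mem_Ioc] at hk
      have hdk : 3 ≤ d * k := by
        have h1 : x + 2 < d * k := by
          have := (Nat.div_lt_iff_lt_mul hd).1 hk.1; rw [mul_comm] at this; exact this
        omega
      exact kcond_iff hzw hdw hdk
    have e3 := sum_filter_classes_shift hK (Nat.primesBelow ⌈w⌉₊) Kc
      (fun p hp => ⟨(Nat.mem_primesBelow.1 hp).2.pos, hKc_lt p (Nat.mem_primesBelow.1 hp).2⟩) (fun _ => (1 : ℝ))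
    rw [e1]
    calc ∑ n ∈ (Finset.Ioc x (2 * x)).filter (fun n : ℕ =>
          ((∀ p ∈ (n + 2 - 2).primeFactors, z ≤ (p : ℝ)) ∧ w ≤ ((n + 2).minFac : ℝ)) ∧ d ∣ n + 2), (1 : ℝ)
        = ∑ k ∈ (Finset.Ioc K₀ K₁).filter (fun k => (∀ p ∈ (d * k - 2).primeFactors, z ≤ (p : ℝ)) ∧
            w ≤ ((d * k).minFac : ℝ)), (1 : ℝ) := by convert hshift using 2
      _ = ∑ k ∈ (Finset.Ioc K₀ K₁).filter (fun k => ∀ p ∈ Nat.primesBelow ⌈w⌉₊, k % p ∉ Kc p), (1 : ℝ) := by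
          rw [e2]
      _ = ∑ r ∈ (Finset.Icc 1 (K₁ - K₀)).filter (fun r => ∀ p ∈ Nat.primesBelow ⌈w⌉₊,
            r % p ∉ (Kc p).image (fun u : ℕ => (u + (p - K₀ % p)) % p)), (1 : ℝ) := by convert e3 using 2
      _ = _ := by rw [Finset.sum_const, nsmul_eq_mul, mul_one]
  -- Step 2: the interval sieve
  set Kc' : ℕ → Finset ℕ := fun p => (Kc p).image (fun u : ℕ => (u + (p - K₀ % p)) % p) with hKc'
  have hKc'_lt : ∀ p : ℕ, p.Prime → ∀ r ∈ Kc' p, r < p := fun p hp =>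
    shift_classes_lt hp.pos K₀ (Kc p)
  have hcard : ∀ p : ℕ, p.Prime → #(Kc' p) = #(Kc p) := fun p hp =>
    card_shift_classes hp.pos K₀ (hKc_lt p hp)
  have hKc_card : ∀ p : ℕ, p.Prime → #(Kc p) = if (p : ℝ) < z then (if p = 2 then 1 else 2) else 1 := by
    intro p hp
    simp only [hKc]
    split_ifs with h h2
    · subst h2; rw [val_two_mul_inv_two]; rfl
    · have hne := val_two_mul_inv_ne_zero hp h2 (hdw p hp (h.trans_le hzw))
      rw [Finset.card_insert_of_notMem (by rw [Finset.mem_singleton]; exact fun e => hne e.symm),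
        Finset.card_singleton]
    · rfl
  have hle2 : ∀ p : ℕ, p.Prime → #(Kc' p) ≤ 2 := by
    intro p hp; rw [hcard p hp, hKc_card p hp]; split_ifs <;> norm_num
  have hltp : ∀ p : ℕ, p.Prime → #(Kc' p) < p := by
    intro p hp; rw [hcard p hp, hKc_card p hp]
    have := hp.two_le
    split_ifs with h h2 <;> omega
  have hmain := hI (K₁ - K₀) Kc' hKc'_lt hle2 hltp w L (by linarith) hwL
  -- Step 3: the density product
  have hprod : ∏ p ∈ Nat.primesBelow ⌈w⌉₊, (1 - (#(Kc' p) : ℝ) / p) =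
      (∏ p ∈ (Finset.range ⌈z⌉₊).filter Nat.Prime, (1 - 1 / (p : ℝ))) *
        (∏ p ∈ (Finset.range ⌈z⌉₊).filter (fun p : ℕ => p.Prime ∧ p ≠ 2), (1 - 1 / ((p : ℝ) - 1))) *
        ∏ p ∈ (Nat.primesBelow ⌈w⌉₊).filter (fun p : ℕ => z ≤ (p : ℝ)), (1 - 1 / (p : ℝ)) := by
    have e : ∏ p ∈ Nat.primesBelow ⌈w⌉₊, (1 - (#(Kc' p) : ℝ) / p) =
        ∏ p ∈ Nat.primesBelow ⌈w⌉₊, (1 - ((fun p => #(Kc' p)) p : ℝ) / p) := rfl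
    rw [e]
    refine prod_classes_eq hz2 hzw (fun p => #(Kc' p)) ?_ ?_ ?_
    · show #(Kc' 2) = 1
      rw [hcard 2 Nat.prime_two, hKc_card 2 Nat.prime_two]
      simp only [if_true]; split_ifs <;> rfl
    · intro p hp hp2
      have hpp := (Nat.mem_primesBelow.1 hp).2
      have hpz : (p : ℝ) < z := Nat.lt_ceil.1 (Nat.mem_primesBelow.1 hp).1
      show #(Kc' p) = 2
      rw [hcard p hpp, hKc_card p hpp, if_pos hpz, if_neg hp2]
    · intro p hp hzp
      have hpp := (Nat.mem_primesBelow.1 hp).2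
      show #(Kc' p) = 1
      rw [hcard p hpp, hKc_card p hpp, if_neg (not_lt.2 hzp)]
  rw [hcount, ← hprod]
  exact hmain

end Summit.Parity.GeneralizedHardyLittlewood.Theorems.ParityLeakOneFifth
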